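import Mathlib.LinearAlgebra.Matrix.Transvection
import Mathlib.LinearAlgebra.Basis.VectorSpace
import Mathlib.LinearAlgebra.Isomorphisms
import Literature.NumberTheory.Automorphic.UnitaryGroupFormTransport
import HarnessLib

/-!
# The doubled (quasi-split) unitary group `U(𝕍 ⊕ −𝕍)` is the normal closure of its Siegel parabolic `P_Δ`

Topic `NumberTheory/Automorphic`; namespace `Literature.NumberTheory.Automorphic` (grouping sub-namespace
`DoubledUnitary`).  KERNEL only: definitions with bodies and proved lemmas; no named fact, no `sorry`.

Setting ([Kudla1994, §3]; [HarrisKudlaSweet1996, §1 (1.9)–(1.11)]): `K` a field with a ring involution `σ`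
(`σ ∘ σ = id`) admitting `θ ≠ 0` with `σ θ = −θ` (e.g. a CM field with complex conjugation), `2 ≠ 0` in `K`, and
`S ∈ GL_n(K)` symmetric and `σ`-fixed.  The DOUBLED hermitian space `𝔻 = 𝕍 ⊕ (−𝕍)` has Gram matrix
`S ⊕ (−S)`; it is split, the diagonal `Δ = {(u, u)}` being maximal isotropic, and the stabiliser of `Δ` in
`H = U(𝔻) = unitaryGroupOfForm σ (S ⊕ −S)` is the Siegel parabolic `P_Δ = {p ∣ p₁₁ + p₁₂ = p₂₁ + p₂₂}`.

MAIN RESULT (`DoubledUnitary.mem_closure_siegelConjugates_diag` in the block enumeration `ι ⊕ ι`; re-enumerated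
along any `e : ι ⊕ ι ≃ m`, e.g. `finSumFinEquiv`, in `DoubledUnitary.mem_closure_siegelConjugates_reindex`; and typed
on the subgroup `↥U(σ, J)` for an arbitrary spelling `J = reindex e e (S ⊕ −S)` in
`DoubledUnitary.mem_closure_siegelConjugates_subtype`): **every element of `H(K)` lies in the subgroup generated by
the `H(K)`-conjugates of `P_Δ(K)`** — i.e. `H(K)` is the normal closure of its Siegel parabolic.  Route (elementary, no
Bruhat induction): after the change of basis `(u, v) ↦ (u + v, u − v)` the form becomes `J' = antidiag(τ, τ)`,
`τ = 2S`, and `P_Δ` becomes the block-upper-triangular subgroup `P`; the opposite unipotent radical is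
`N⁻ = w N w⁻¹` (`w = antidiag(1, 1) ∈ H`), the big cell `{g ∣ g₁₁ invertible} = N⁻ · P` lies in the normal closure,
and for a `g` with SINGULAR `g₁₁` an explicit `n⁺(y) ∈ N` (built from a pivot normal form of `g₁₁`,
`Matrix.Pivot.exists_list_transvec_mul_mul_list_transvec_eq_diagonal`, and the element `θ`) makes `(n⁺(y) g)₁₁`
invertible.

Written as the GENERIC input of stub S2 (`stub_S2_ratH_normalClosure_siegel`) of the kernel construction of
[GelbartRogawski1991, Prop. 3.1.1] behind the cited input `hGRU` of the Hodge-CM period-theorem package (stage-1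
cell `pub-hodgecm`, seats GR-1 ∕ GR-2; this file: seat carch-1, 2026-08-21): there `K = L` (CM), `σ` = complex
conjugation, `S = T ⊗ 1` with `T` the rational Gram matrix, and the rational points are pushed to `H(𝔸)` by
`UnitaryGroup.toAdelic` (`IsSiegelFin.map`).

## References

* S. S. Kudla, Israel J. Math. 87 (1994) 361–401, §3 [Kudla1994].
* M. Harris, S. S. Kudla, W. J. Sweet, J. Amer. Math. Soc. 9 (1996) 941–1004, §1 (1.9)–(1.11)
  [HarrisKudlaSweet1996].
* A. Borel, *Linear Algebraic Groups*, 2nd ed., GTM 126 (1991), §14.21 (the big cell), §21.15 [Borel1991].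
-/

set_option autoImplicit false

noncomputable section

open scoped Matrix MatrixGroups
open Matrix

namespace Literature.NumberTheory.Automorphic

/-! ## §0 Normal closures of a subset inside a subgroup, and their transport along homomorphisms -/

section Conjugates

variable {G G' : Type*} [Group G] [Group G']

/-- The `U`-conjugates `h p h⁻¹` (`h ∈ U`) of the elements `p ∈ U` satisfying `P`. [folklore] -/
def conjugatesOfIn (U : Subgroup G) (P : G → Prop) : Set G :=
  {x | ∃ p ∈ U, ∃ h ∈ U, P p ∧ x = h * p * h⁻¹}

/-- An element of `U` satisfying `P` is one of the conjugates (`h = 1`). [folklore] -/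
private theorem mem_conjugatesOfIn_self {U : Subgroup G} {P : G → Prop} {p : G} (hpU : p ∈ U) (hp : P p) :
    p ∈ conjugatesOfIn U P :=
  ⟨p, hpU, 1, U.one_mem, hp, by simp⟩

/-- `h p h⁻¹` is one of the conjugates. [folklore] -/
private theorem conj_mem_conjugatesOfIn {U : Subgroup G} {P : G → Prop} {p h : G} (hpU : p ∈ U) (hhU : h ∈ U)
    (hp : P p) : h * p * h⁻¹ ∈ conjugatesOfIn U P :=
  ⟨p, hpU, h, hhU, hp, rfl⟩

/-- The conjugates lie in `U`, hence so does the subgroup they generate. [folklore] -/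
private theorem closure_conjugatesOfIn_le (U : Subgroup G) (P : G → Prop) :
    Subgroup.closure (conjugatesOfIn U P) ≤ U := by
  rw [Subgroup.closure_le]
  rintro x ⟨p, hp, h, hh, -, rfl⟩
  exact U.mul_mem (U.mul_mem hh hp) (U.inv_mem hh)

/-- **Transport**: a homomorphism `φ` mapping `U` into `U'` and `P`-elements of `U` to `P'`-elements maps the
subgroup generated by the `U`-conjugates of `P` into the one generated by the `U'`-conjugates of `P'`. [folklore] -/
private theorem map_closure_conjugatesOfIn_le (φ : G →* G') {U : Subgroup G} {U' : Subgroup G'} {P : G → Prop}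
    {P' : G' → Prop} (hU : ∀ g ∈ U, φ g ∈ U') (hP : ∀ p ∈ U, P p → P' (φ p)) :
    (Subgroup.closure (conjugatesOfIn U P)).map φ ≤ Subgroup.closure (conjugatesOfIn U' P') := by
  rw [MonoidHom.map_closure]
  apply Subgroup.closure_mono
  rintro _ ⟨x, ⟨p, hp, h, hh, hP', rfl⟩, rfl⟩
  exact ⟨φ p, hU p hp, φ h, hU h hh, hP p hp hP', by simp [map_mul, map_inv]⟩

/-- From the ambient formulation to the one inside the subgroup `U` (as used by consumers typed on `↥U`):
if `g ∈ U` lies in the closure of the `U`-conjugates of `P`, then `⟨g, _⟩` lies in the closure, in `↥U`, of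
`{h p h⁻¹ ∣ P p}`. [folklore] -/
private theorem mem_closure_subtype_of_mem_closure_conjugatesOfIn {U : Subgroup G} {P : G → Prop} {g : G}
    (hgU : g ∈ U) (hg : g ∈ Subgroup.closure (conjugatesOfIn U P)) :
    (⟨g, hgU⟩ : U) ∈ Subgroup.closure {x : U | ∃ p h : U, P (p : G) ∧ x = h * p * h⁻¹} := by
  set T : Set U := {x : U | ∃ p h : U, P (p : G) ∧ x = h * p * h⁻¹}
  have himg : conjugatesOfIn U P ⊆ (U.subtype : U →* G) '' T := by
    rintro _ ⟨p, hp, h, hh, hP, rfl⟩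
    exact ⟨⟨h, hh⟩ * ⟨p, hp⟩ * ⟨h, hh⟩⁻¹, ⟨⟨p, hp⟩, ⟨h, hh⟩, hP, rfl⟩, rfl⟩
  have hle : Subgroup.closure (conjugatesOfIn U P) ≤ (Subgroup.closure T).map U.subtype := by
    rw [MonoidHom.map_closure]
    exact Subgroup.closure_mono himg
  obtain ⟨t, ht, hteq⟩ := Subgroup.mem_map.1 (hle hg)
  have : t = ⟨g, hgU⟩ := Subtype.ext hteq
  exact this ▸ ht

end Conjugates

namespace DoubledUnitary

variable {K : Type*} [Field K] {ι : Type*} [Fintype ι] [DecidableEq ι] (σ : K →+* K)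

/-! ## §1 The anti-diagonal model `J' = antidiag(τ, τ)`: unipotent radicals `N^±`, the Weyl element, the big cell -/

/-- `J' = antidiag(τ, τ)`: the doubled form in the basis adapted to the polarisation `𝔻 = Δ ⊕ Δ⁻`
(`Δ^± = {(u, ±u)}`). [cite: HarrisKudlaSweet1996, §1 (1.11)] -/
def antidiagForm (τ : Matrix ι ι K) : Matrix (ι ⊕ ι) (ι ⊕ ι) K := Matrix.fromBlocks 0 τ τ 0

/-- the SIEGEL condition in the anti-diagonal model: the lower-left block vanishes (`g` stabilises `Δ`).
[cite: HarrisKudlaSweet1996, §1 (1.11)] -/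
def IsBlockUpper (g : GL (ι ⊕ ι) K) : Prop := (g : Matrix (ι ⊕ ι) (ι ⊕ ι) K).toBlocks₂₁ = 0

/-- `n⁺(y) = [[1, y], [0, 1]]`. [folklore] -/
def upperUnipotent (y : Matrix ι ι K) : GL (ι ⊕ ι) K :=
  ⟨Matrix.fromBlocks 1 y 0 1, Matrix.fromBlocks 1 (-y) 0 1,
    by simp [Matrix.fromBlocks_multiply, Matrix.fromBlocks_one],
    by simp [Matrix.fromBlocks_multiply, Matrix.fromBlocks_one]⟩

/-- `n⁻(x) = [[1, 0], [x, 1]]`. [folklore] -/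
def lowerUnipotent (x : Matrix ι ι K) : GL (ι ⊕ ι) K :=
  ⟨Matrix.fromBlocks 1 0 x 1, Matrix.fromBlocks 1 0 (-x) 1,
    by simp [Matrix.fromBlocks_multiply, Matrix.fromBlocks_one],
    by simp [Matrix.fromBlocks_multiply, Matrix.fromBlocks_one]⟩

/-- the Weyl element `w = antidiag(1, 1)` (swaps `Δ` and `Δ⁻`). [folklore] -/
def weylSwap : GL (ι ⊕ ι) K :=
  ⟨Matrix.fromBlocks 0 1 1 0, Matrix.fromBlocks 0 1 1 0,
    by simp [Matrix.fromBlocks_multiply, Matrix.fromBlocks_one],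
    by simp [Matrix.fromBlocks_multiply, Matrix.fromBlocks_one]⟩

/-- underlying matrix of `n⁺(y)`. [folklore] -/
@[simp] private theorem coe_upperUnipotent (y : Matrix ι ι K) :
    ((upperUnipotent y : GL (ι ⊕ ι) K) : Matrix (ι ⊕ ι) (ι ⊕ ι) K) = Matrix.fromBlocks 1 y 0 1 := rfl

/-- underlying matrix of `n⁻(x)`. [folklore] -/
@[simp] private theorem coe_lowerUnipotent (x : Matrix ι ι K) :
    ((lowerUnipotent x : GL (ι ⊕ ι) K) : Matrix (ι ⊕ ι) (ι ⊕ ι) K) = Matrix.fromBlocks 1 0 x 1 := rfl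

/-- underlying matrix of `w`. [folklore] -/
@[simp] private theorem coe_weylSwap :
    ((weylSwap : GL (ι ⊕ ι) K) : Matrix (ι ⊕ ι) (ι ⊕ ι) K) = Matrix.fromBlocks 0 1 1 0 := rfl

/-- underlying matrix of `n⁺(y)⁻¹ = n⁺(−y)`. [folklore] -/
@[simp] private theorem coe_upperUnipotent_inv (y : Matrix ι ι K) :
    (((upperUnipotent y)⁻¹ : GL (ι ⊕ ι) K) : Matrix (ι ⊕ ι) (ι ⊕ ι) K) = Matrix.fromBlocks 1 (-y) 0 1 := rfl

/-- underlying matrix of `n⁻(x)⁻¹ = n⁻(−x)`. [folklore] -/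
@[simp] private theorem coe_lowerUnipotent_inv (x : Matrix ι ι K) :
    (((lowerUnipotent x)⁻¹ : GL (ι ⊕ ι) K) : Matrix (ι ⊕ ι) (ι ⊕ ι) K) = Matrix.fromBlocks 1 0 (-x) 1 := rfl

/-- `w⁻¹ = w`. [folklore] -/
@[simp] private theorem coe_weylSwap_inv :
    ((weylSwap⁻¹ : GL (ι ⊕ ι) K) : Matrix (ι ⊕ ι) (ι ⊕ ι) K) = Matrix.fromBlocks 0 1 1 0 := rfl

omit [Fintype ι] [DecidableEq ι] in
/-- `σ` applied entrywise commutes with the block structure. [folklore] -/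
private theorem fromBlocks_map_ringHom (A B C D : Matrix ι ι K) :
    (Matrix.fromBlocks A B C D).map σ = Matrix.fromBlocks (A.map σ) (B.map σ) (C.map σ) (D.map σ) :=
  Matrix.fromBlocks_map A B C D σ

omit [Fintype ι] in
/-- `σ(1) = 1` entrywise. [folklore] -/
@[simp] private theorem map_one_ringHom : (1 : Matrix ι ι K).map σ = 1 := Matrix.map_one σ (map_zero σ) (map_one σ)

omit [Fintype ι] [DecidableEq ι] in
/-- `σ(0) = 0` entrywise. [folklore] -/
@[simp] private theorem map_zero_ringHom : (0 : Matrix ι ι K).map σ = 0 := Matrix.map_zero σ (map_zero σ)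

omit [Fintype ι] in
/-- `σ(−1) = −1` entrywise. [folklore] -/
@[simp] private theorem map_neg_one_ringHom : (-1 : Matrix ι ι K).map σ = -1 := by
  ext i j
  simp [Matrix.one_apply, apply_ite σ]

/-- `n⁺(y) ∈ U(σ, J')` iff `τ y + σ(y)ᵀ τ = 0` (we only need "if"). [folklore] -/
private theorem upperUnipotent_mem {τ y : Matrix ι ι K} (hy : τ * y + (y.map σ)ᵀ * τ = 0) :
    upperUnipotent y ∈ unitaryGroupOfForm σ (antidiagForm τ) := by
  rw [mem_unitaryGroupOfForm_iff, coe_upperUnipotent, antidiagForm, fromBlocks_map_ringHom,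
    Matrix.fromBlocks_transpose]
  simp only [map_one_ringHom, map_zero_ringHom, Matrix.transpose_one, Matrix.transpose_zero,
    Matrix.fromBlocks_multiply, Matrix.mul_zero, Matrix.zero_mul, Matrix.one_mul, Matrix.mul_one, add_zero,
    zero_add]
  rw [hy]

/-- `n⁻(x) ∈ U(σ, J')` iff `σ(x)ᵀ τ + τ x = 0` (we only need "if"). [folklore] -/
private theorem lowerUnipotent_mem {τ x : Matrix ι ι K} (hx : (x.map σ)ᵀ * τ + τ * x = 0) :
    lowerUnipotent x ∈ unitaryGroupOfForm σ (antidiagForm τ) := by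
  rw [mem_unitaryGroupOfForm_iff, coe_lowerUnipotent, antidiagForm, fromBlocks_map_ringHom,
    Matrix.fromBlocks_transpose]
  simp only [map_one_ringHom, map_zero_ringHom, Matrix.transpose_one, Matrix.transpose_zero,
    Matrix.fromBlocks_multiply, Matrix.mul_zero, Matrix.zero_mul, Matrix.one_mul, Matrix.mul_one, add_zero,
    zero_add]
  rw [hx]

/-- `w ∈ U(σ, J')`. [folklore] -/
private theorem weylSwap_mem (τ : Matrix ι ι K) : weylSwap ∈ unitaryGroupOfForm σ (antidiagForm τ) := by
  rw [mem_unitaryGroupOfForm_iff, coe_weylSwap, antidiagForm, fromBlocks_map_ringHom, Matrix.fromBlocks_transpose]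
  simp [Matrix.fromBlocks_multiply]

/-- `w n⁺(x) w⁻¹ = n⁻(x)`: the opposite unipotent radical is conjugate to `N ⊆ P`. [folklore] -/
private theorem weylSwap_conj_upperUnipotent (x : Matrix ι ι K) :
    (weylSwap : GL (ι ⊕ ι) K) * upperUnipotent x * weylSwap⁻¹ = lowerUnipotent x := by
  apply Units.ext
  rw [Units.val_mul, Units.val_mul, coe_weylSwap, coe_upperUnipotent, coe_weylSwap_inv, coe_lowerUnipotent]
  simp [Matrix.fromBlocks_multiply]

/-- `n⁺(y)` is block-upper. [folklore] -/
private theorem isBlockUpper_upperUnipotent (y : Matrix ι ι K) : IsBlockUpper (upperUnipotent y) := by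
  simp [IsBlockUpper]

section BigCell

variable {τ : Matrix ι ι K}

/-- the `(1,1)`-block equation of `σ(g)ᵀ J' g = J'`: `σ(c)ᵀ τ a + σ(a)ᵀ τ c = 0` (isotropy of `g Δ`).
[cite: HarrisKudlaSweet1996, §1 (1.11)] -/
private theorem blocks_rel₁₁ {g : GL (ι ⊕ ι) K} (hg : g ∈ unitaryGroupOfForm σ (antidiagForm τ)) :
    ((g : Matrix (ι ⊕ ι) (ι ⊕ ι) K).toBlocks₂₁.map σ)ᵀ * τ * (g : Matrix (ι ⊕ ι) (ι ⊕ ι) K).toBlocks₁₁ +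
      ((g : Matrix (ι ⊕ ι) (ι ⊕ ι) K).toBlocks₁₁.map σ)ᵀ * τ * (g : Matrix (ι ⊕ ι) (ι ⊕ ι) K).toBlocks₂₁ = 0 := by
  rw [mem_unitaryGroupOfForm_iff] at hg
  set M := (g : Matrix (ι ⊕ ι) (ι ⊕ ι) K) with hM
  have hM' : M = Matrix.fromBlocks M.toBlocks₁₁ M.toBlocks₁₂ M.toBlocks₂₁ M.toBlocks₂₂ :=
    (Matrix.fromBlocks_toBlocks M).symm
  rw [hM', antidiagForm, fromBlocks_map_ringHom, Matrix.fromBlocks_transpose] at hg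
  simp only [Matrix.fromBlocks_multiply, Matrix.mul_zero, add_zero, zero_add] at hg
  have h11 := congrArg Matrix.toBlocks₁₁ hg
  simp only [Matrix.toBlocks_fromBlocks₁₁] at h11
  exact h11

/-- **The big cell lies in the normal closure of `P`**: if `g ∈ U(σ, J')` has invertible `(1,1)`-block then
`g = n⁻(c a⁻¹) · p` with `p` block-upper, and `n⁻(c a⁻¹) = w n⁺(c a⁻¹) w⁻¹`. [cite: Borel1991, §14.21] -/
theorem mem_closure_of_isUnit_block₁₁ {g : GL (ι ⊕ ι) K}
    (hg : g ∈ unitaryGroupOfForm σ (antidiagForm τ))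
    (ha : IsUnit (g : Matrix (ι ⊕ ι) (ι ⊕ ι) K).toBlocks₁₁) :
    g ∈ Subgroup.closure (conjugatesOfIn (unitaryGroupOfForm σ (antidiagForm τ)) IsBlockUpper) := by
  set U := unitaryGroupOfForm σ (antidiagForm τ)
  set M := (g : Matrix (ι ⊕ ι) (ι ⊕ ι) K) with hM
  set a := M.toBlocks₁₁
  set c := M.toBlocks₂₁
  have hadet : IsUnit a.det := (Matrix.isUnit_iff_isUnit_det _).1 ha
  set x := c * a⁻¹ with hx
  -- `σ(x)ᵀ τ + τ x = σ(a)ᵀ⁻¹ (σ(c)ᵀ τ a + σ(a)ᵀ τ c) a⁻¹ = 0` by the (1,1)-relation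
  have hrel := blocks_rel₁₁ σ hg
  have haσ : IsUnit (a.map σ).det := by
    rw [← RingHom.mapMatrix_apply, ← RingHom.map_det]
    exact hadet.map σ
  have hainv_map : a⁻¹.map σ = (a.map σ)⁻¹ := by
    refine (Matrix.inv_eq_left_inv ?_).symm
    rw [← Matrix.map_mul, Matrix.nonsing_inv_mul a hadet, map_one_ringHom]
  have hdetσT : IsUnit (a.map σ)ᵀ.det := by rwa [Matrix.det_transpose]
  have hcond : (x.map σ)ᵀ * τ + τ * x = 0 := by
    have key : ((a.map σ)ᵀ)⁻¹ * ((c.map σ)ᵀ * τ * a + (a.map σ)ᵀ * τ * c) * a⁻¹ =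
        (x.map σ)ᵀ * τ + τ * x := by
      rw [Matrix.mul_add, Matrix.add_mul, hx, Matrix.map_mul, Matrix.transpose_mul, hainv_map,
        Matrix.transpose_nonsing_inv]
      congr 1
      · simp only [Matrix.mul_assoc, Matrix.mul_nonsing_inv a hadet, Matrix.mul_one]
      · simp only [Matrix.mul_assoc]
        rw [← Matrix.mul_assoc ((a.map σ)ᵀ)⁻¹ (a.map σ)ᵀ, Matrix.nonsing_inv_mul _ hdetσT, Matrix.one_mul]
    rw [← key, hrel, Matrix.mul_zero, Matrix.zero_mul]
  have hxU : lowerUnipotent x ∈ U := lowerUnipotent_mem σ hcond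
  have hxU' : upperUnipotent x ∈ U := upperUnipotent_mem σ (by rw [add_comm]; exact hcond)
  -- `p := n⁻(x)⁻¹ g` is block-upper
  have hpU : (lowerUnipotent x)⁻¹ * g ∈ U := U.mul_mem (U.inv_mem hxU) hg
  have hp : IsBlockUpper ((lowerUnipotent x)⁻¹ * g) := by
    have hM' : M = Matrix.fromBlocks a M.toBlocks₁₂ c M.toBlocks₂₂ := (Matrix.fromBlocks_toBlocks M).symm
    show (((lowerUnipotent x)⁻¹ * g : GL (ι ⊕ ι) K) : Matrix (ι ⊕ ι) (ι ⊕ ι) K).toBlocks₂₁ = 0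
    rw [Units.val_mul, coe_lowerUnipotent_inv, ← hM, hM', Matrix.fromBlocks_multiply, Matrix.toBlocks_fromBlocks₂₁,
      hx, Matrix.neg_mul, Matrix.mul_assoc, Matrix.nonsing_inv_mul a hadet]
    simp
  -- assemble: `g = n⁻(x) · p`, `n⁻(x) = w n⁺(x) w⁻¹`
  have hn : lowerUnipotent x ∈ Subgroup.closure (conjugatesOfIn U IsBlockUpper) := by
    rw [← weylSwap_conj_upperUnipotent]
    exact Subgroup.subset_closure (conj_mem_conjugatesOfIn hxU' (weylSwap_mem σ τ) (isBlockUpper_upperUnipotent x))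
  have hpc : (lowerUnipotent x)⁻¹ * g ∈ Subgroup.closure (conjugatesOfIn U IsBlockUpper) :=
    Subgroup.subset_closure (mem_conjugatesOfIn_self hpU hp)
  rw [← mul_inv_cancel_left (lowerUnipotent x) g]
  exact Subgroup.mul_mem _ hn hpc

end BigCell

/-! ## §2 Elements with a singular `(1,1)`-block: an explicit `n⁺(y)` moving them into the big cell -/

section Factor

omit [DecidableEq ι] in
/-- Row-space factorisation over a field: if every column vector killed by `A` is killed by `B`, then `B = Γ A`
for some square `Γ` (descend `B` to `range A ≅ V ⧸ ker A` and extend to `V`). [folklore] -/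
private theorem exists_mul_eq_of_mulVec_eq_zero [DecidableEq ι] (A B : Matrix ι ι K)
    (h : ∀ v, A *ᵥ v = 0 → B *ᵥ v = 0) : ∃ Γ : Matrix ι ι K, Γ * A = B := by
  let fA := Matrix.toLin' A
  let fB := Matrix.toLin' B
  have hker : LinearMap.ker fA ≤ LinearMap.ker fB := fun v hv => by
    simp only [LinearMap.mem_ker, fA, fB, Matrix.toLin'_apply] at hv ⊢
    exact h v hv
  let fBbar : LinearMap.range fA →ₗ[K] (ι → K) :=
    ((LinearMap.ker fA).liftQ fB hker).comp fA.quotKerEquivRange.symm.toLinearMap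
  obtain ⟨Γl, hΓl⟩ := LinearMap.exists_extend fBbar
  have hcomp : Γl.comp fA = fB := by
    apply LinearMap.ext
    intro v
    have hmem : fA v ∈ LinearMap.range fA := LinearMap.mem_range_self fA v
    have h1 : Γl (fA v) = fBbar ⟨fA v, hmem⟩ := by rw [← hΓl]; rfl
    rw [LinearMap.comp_apply, h1]
    simp only [fBbar, LinearMap.comp_apply, LinearEquiv.coe_toLinearMap,
      LinearMap.quotKerEquivRange_symm_apply_image, Submodule.mkQ_apply, Submodule.liftQ_apply]
  refine ⟨LinearMap.toMatrix' Γl, ?_⟩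
  calc LinearMap.toMatrix' Γl * A = LinearMap.toMatrix' Γl * LinearMap.toMatrix' fA := by
        rw [LinearMap.toMatrix'_toLin']
    _ = LinearMap.toMatrix' (Γl.comp fA) := (LinearMap.toMatrix'_comp _ _).symm
    _ = B := by rw [hcomp, LinearMap.toMatrix'_toLin']

omit [Fintype ι] [DecidableEq ι] in
/-- `σ(σ(X)) = X` entrywise for an involution `σ`. [folklore] -/
private theorem map_map_invol (hσ : ∀ x, σ (σ x) = x) (X : Matrix ι ι K) : (X.map σ).map σ = X := by
  ext i j; simp [hσ]

omit [DecidableEq ι] in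
/-- `σ(X)ᵀ F X` is `σ`-hermitian when `F` is. [folklore] -/
private theorem sandwich_hermitian (hσ : ∀ x, σ (σ x) = x) (F X : Matrix ι ι K) (hF : (F.map σ)ᵀ = F) :
    (((X.map σ)ᵀ * F * X).map σ)ᵀ = (X.map σ)ᵀ * F * X := by
  rw [Matrix.map_mul, Matrix.map_mul, Matrix.transpose_mul, Matrix.transpose_mul, Matrix.transpose_map,
    map_map_invol σ hσ, Matrix.transpose_transpose, hF, Matrix.mul_assoc]

end Factor

section Singular

variable {τ : Matrix ι ι K}

/-- **Moving a singular element into the big cell.**  For every `g ∈ U(σ, J')` there is `y` with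
`τ y + σ(y)ᵀ τ = 0` (so `n⁺(y) ∈ N ⊆ P`) such that `(n⁺(y) g)₁₁ = g₁₁ + y g₂₁` is invertible.  Construction:
pivot `α g₁₁ β = diag D`; `f` = indicator of `{D = 0}`, `f̃ = β f β⁻¹` (a projection onto `ker g₁₁`); `Γ` with
`Γ (g₂₁ f̃) = f̃` (exists: `g` is invertible); `W = σ(β⁻¹)ᵀ f β⁻¹`, `M = σ(Γ)ᵀ W Γ`, `y = τ⁻¹ (θ M)`; the
isotropy relation `σ(g₂₁)ᵀ τ g₁₁ + σ(g₁₁)ᵀ τ g₂₁ = 0` gives `σ(g₂₁ f̃)ᵀ τ g₁₁ = 0`, whence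
`(g₁₁ + y g₂₁) u = 0 ⇒ W Γ g₂₁ u = 0 ⇒ g₁₁ u = 0 ⇒ u = f̃ u ⇒ W u = 0 ⇒ u = 0`. [folklore] -/
private theorem exists_upperUnipotent_isUnit_block₁₁ (hσ : ∀ x, σ (σ x) = x) {θ : K} (hθ : σ θ = -θ) (hθ0 : θ ≠ 0)
    (hτ : τ.map σ = τ) (hτs : τᵀ = τ) (hτu : IsUnit τ.det) {g : GL (ι ⊕ ι) K}
    (hg : g ∈ unitaryGroupOfForm σ (antidiagForm τ)) :
    ∃ y : Matrix ι ι K, τ * y + (y.map σ)ᵀ * τ = 0 ∧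
      IsUnit ((upperUnipotent y * g : GL (ι ⊕ ι) K) : Matrix (ι ⊕ ι) (ι ⊕ ι) K).toBlocks₁₁ := by
  classical
  set M := (g : Matrix (ι ⊕ ι) (ι ⊕ ι) K) with hM
  set a := M.toBlocks₁₁
  set b := M.toBlocks₁₂
  set c := M.toBlocks₂₁
  set d := M.toBlocks₂₂
  have hMblk : M = Matrix.fromBlocks a b c d := (Matrix.fromBlocks_toBlocks M).symm
  have hrel : (c.map σ)ᵀ * τ * a + (a.map σ)ᵀ * τ * c = 0 := blocks_rel₁₁ σ hg
  -- pivot normal form of `a`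
  obtain ⟨L, L', D, hD⟩ := Matrix.Pivot.exists_list_transvec_mul_mul_list_transvec_eq_diagonal a
  set α := (L.map Matrix.TransvectionStruct.toMatrix).prod with hα
  set β := (L'.map Matrix.TransvectionStruct.toMatrix).prod with hβ
  have hαd : IsUnit α.det := by rw [hα, Matrix.TransvectionStruct.det_toMatrix_prod]; exact isUnit_one
  have hβd : IsUnit β.det := by rw [hβ, Matrix.TransvectionStruct.det_toMatrix_prod]; exact isUnit_one
  have ha : α⁻¹ * Matrix.diagonal D * β⁻¹ = a := by
    rw [← hD]
    simp only [Matrix.mul_assoc, Matrix.mul_nonsing_inv β hβd, Matrix.mul_one]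
    rw [← Matrix.mul_assoc, Matrix.nonsing_inv_mul α hαd, Matrix.one_mul]
  have hαa : α * a = Matrix.diagonal D * β⁻¹ := by
    rw [← ha]
    simp only [← Matrix.mul_assoc, Matrix.mul_nonsing_inv α hαd, Matrix.one_mul]
  -- the indicator `f` of `{D = 0}` and the projection `f̃ = β f β⁻¹` onto `ker a`
  set χ : ι → K := fun i => if D i = 0 then 1 else 0 with hχ
  set f : Matrix ι ι K := Matrix.diagonal χ with hf
  have hDf : Matrix.diagonal D * f = 0 := by
    rw [hf, Matrix.diagonal_mul_diagonal, ← Matrix.diagonal_zero]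
    congr 1; funext i
    by_cases hi : D i = 0 <;> simp [hχ, hi]
  have hff : f * f = f := by
    rw [hf, Matrix.diagonal_mul_diagonal]
    congr 1; funext i
    by_cases hi : D i = 0 <;> simp [hχ, hi]
  have hfT : fᵀ = f := Matrix.diagonal_transpose χ
  have hfσ : f.map σ = f := by
    rw [hf, Matrix.diagonal_map (map_zero σ)]
    congr 1; funext i
    by_cases hi : D i = 0 <;> simp [hχ, hi]
  set βi := β⁻¹ with hβi
  have hβid : IsUnit βi.det := Matrix.isUnit_det_of_right_inverse (Matrix.nonsing_inv_mul β hβd)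
  set ft := β * f * βi with hft
  set N := c * ft with hN
  have haft : a * ft = 0 := by
    rw [← ha, hft]
    simp only [Matrix.mul_assoc]
    rw [← Matrix.mul_assoc βi β, hβi, Matrix.nonsing_inv_mul β hβd, Matrix.one_mul, ← Matrix.mul_assoc (Matrix.diagonal D) f,
      hDf, Matrix.zero_mul, Matrix.mul_zero]
  -- `ker N ≤ ker f̃` since `g` is invertible, whence `Γ` with `Γ N = f̃`
  have hker : ∀ u, N *ᵥ u = 0 → ft *ᵥ u = 0 := by
    intro u hu
    have hinj := Matrix.mulVec_injective_iff_isUnit.2 (Units.isUnit g)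
    have h0 : M *ᵥ Sum.elim (ft *ᵥ u) 0 = M *ᵥ 0 := by
      rw [Matrix.mulVec_zero, hMblk, Matrix.fromBlocks_mulVec]
      funext i
      cases i with
      | inl i => simp [Matrix.mulVec_mulVec, haft]
      | inr i => simp [Matrix.mulVec_mulVec, ← hN, hu]
    have hv := hinj h0
    funext i
    simpa using congrFun hv (Sum.inl i)
  obtain ⟨Γ, hΓ⟩ := exists_mul_eq_of_mulVec_eq_zero N ft hker
  -- the hermitian matrices `W`, `Mm` and the skew `y`
  set W := (βi.map σ)ᵀ * f * βi with hW
  set Mm := (Γ.map σ)ᵀ * W * Γ with hMm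
  set y := τ⁻¹ * (θ • Mm) with hy
  have hWh : (W.map σ)ᵀ = W := sandwich_hermitian σ hσ f βi (by rw [hfσ, hfT])
  have hMh : (Mm.map σ)ᵀ = Mm := sandwich_hermitian σ hσ W Γ hWh
  have hτinvσ : τ⁻¹.map σ = τ⁻¹ := by
    refine (Matrix.inv_eq_left_inv ?_).symm
    rw [show τ⁻¹.map σ * τ = τ⁻¹.map σ * τ.map σ by rw [hτ], ← Matrix.map_mul, Matrix.nonsing_inv_mul τ hτu,
      map_one_ringHom]
  have hτy : τ * y = θ • Mm := by rw [hy, ← Matrix.mul_assoc, Matrix.mul_nonsing_inv τ hτu, Matrix.one_mul]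
  refine ⟨y, ?_, ?_⟩
  · -- skewness: `τ y = θ M` with `M` hermitian and `σ θ = -θ`
    rw [hτy, hy, Matrix.map_mul, hτinvσ, Matrix.map_smul' (σ : K → K) θ Mm (map_mul σ), hθ, Matrix.transpose_mul,
      Matrix.transpose_smul, hMh, Matrix.transpose_nonsing_inv, hτs]
    simp only [Matrix.mul_assoc, Matrix.nonsing_inv_mul τ hτu, Matrix.mul_one, neg_smul, add_neg_cancel]
  · -- the `(1,1)`-block of `n⁺(y) g` is `a + y c`; we show it has trivial kernel
    have hblk : ((upperUnipotent y * g : GL (ι ⊕ ι) K) : Matrix (ι ⊕ ι) (ι ⊕ ι) K).toBlocks₁₁ = a + y * c := by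
      rw [Units.val_mul, coe_upperUnipotent, ← hM, hMblk, Matrix.fromBlocks_multiply, Matrix.toBlocks_fromBlocks₁₁,
        Matrix.one_mul]
    rw [hblk]
    -- (LA1) `σ(N)ᵀ τ a = 0`
    have LA1 : (N.map σ)ᵀ * τ * a = 0 := by
      have h1 : (c.map σ)ᵀ * τ * a = -((a.map σ)ᵀ * τ * c) := eq_neg_of_add_eq_zero_left hrel
      calc (N.map σ)ᵀ * τ * a = (ft.map σ)ᵀ * ((c.map σ)ᵀ * τ * a) := by
            rw [hN, Matrix.map_mul, Matrix.transpose_mul]; simp only [Matrix.mul_assoc]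
        _ = -(((a * ft).map σ)ᵀ * τ * c) := by
            rw [h1, Matrix.mul_neg]
            conv_rhs => rw [Matrix.map_mul, Matrix.transpose_mul]
            simp only [Matrix.mul_assoc]
        _ = 0 := by rw [haft]; simp
    -- (LA2) `σ(f̃)ᵀ W = W`
    have hββ : (β.map σ)ᵀ * (βi.map σ)ᵀ = 1 := by
      rw [← Matrix.transpose_mul, ← Matrix.map_mul, hβi, Matrix.nonsing_inv_mul β hβd, map_one_ringHom,
        Matrix.transpose_one]
    have LA2 : (ft.map σ)ᵀ * W = W := by
      calc (ft.map σ)ᵀ * W = (βi.map σ)ᵀ * (f * ((β.map σ)ᵀ * (βi.map σ)ᵀ) * f) * βi := by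
            rw [hft, hW, Matrix.map_mul, Matrix.map_mul, hfσ, Matrix.transpose_mul, Matrix.transpose_mul, hfT]
            simp only [Matrix.mul_assoc]
        _ = W := by rw [hββ, Matrix.mul_one, hff, hW, Matrix.mul_assoc]
    -- (LA3) `σ(N)ᵀ M = W Γ`, (LA4) `σ(N)ᵀ τ (y c) = θ (W Γ c)`
    have LA3 : (N.map σ)ᵀ * Mm = W * Γ := by
      rw [hMm, ← Matrix.mul_assoc, ← Matrix.mul_assoc, ← Matrix.transpose_mul, ← Matrix.map_mul, hΓ, LA2]
    have LA4 : (N.map σ)ᵀ * τ * (y * c) = θ • (W * Γ * c) := by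
      rw [← Matrix.mul_assoc, Matrix.mul_assoc _ τ y, hτy, Matrix.mul_smul, LA3, Matrix.smul_mul]
    -- trivial kernel
    have key : ∀ u, (a + y * c) *ᵥ u = 0 → u = 0 := by
      intro u hu
      -- Step A: `(W Γ c) u = 0`
      have hA : (W * Γ * c) *ᵥ u = 0 := by
        have h1 := congrArg (((N.map σ)ᵀ * τ).mulVec) hu
        simp only [Matrix.mulVec_zero, Matrix.add_mulVec, Matrix.mulVec_add, Matrix.mulVec_mulVec, LA1, LA4,
          Matrix.zero_mulVec, zero_add, Matrix.smul_mulVec, smul_eq_zero] at h1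
        exact h1.resolve_left hθ0
      -- Step B: `y c u = 0`, hence `a u = 0`
      have hB : (y * c) *ᵥ u = 0 := by
        have : y * c = θ • ((τ⁻¹ * (Γ.map σ)ᵀ) * (W * Γ * c)) := by
          rw [hy, hMm]; simp only [Matrix.mul_smul, Matrix.smul_mul, Matrix.mul_assoc]
        rw [this, Matrix.smul_mulVec, ← Matrix.mulVec_mulVec, hA, Matrix.mulVec_zero, smul_zero]
      have hau : a *ᵥ u = 0 := by rwa [Matrix.add_mulVec, hB, add_zero] at hu
      -- Step C: `u = f̃ u`, then `W u = 0`, then `u = 0`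
      have hC1 : Matrix.diagonal D *ᵥ (βi *ᵥ u) = 0 := by
        rw [Matrix.mulVec_mulVec, ← hαa, ← Matrix.mulVec_mulVec, hau, Matrix.mulVec_zero]
      have hC2 : f *ᵥ (βi *ᵥ u) = βi *ᵥ u := by
        funext i
        have hi := congrFun hC1 i
        rw [Matrix.mulVec_diagonal, Pi.zero_apply] at hi
        rw [hf, Matrix.mulVec_diagonal]
        by_cases hDi : D i = 0
        · simp [hχ, hDi]
        · have : (βi *ᵥ u) i = 0 := (mul_eq_zero.1 hi).resolve_left hDi
          simp [hχ, hDi, this]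
      have hC3 : ft *ᵥ u = u := by
        rw [hft, ← Matrix.mulVec_mulVec, ← Matrix.mulVec_mulVec, hC2, Matrix.mulVec_mulVec, hβi,
          Matrix.mul_nonsing_inv β hβd, Matrix.one_mulVec]
      have hC4 : (W * Γ * c) *ᵥ u = W *ᵥ u := by
        calc (W * Γ * c) *ᵥ u = (W * Γ * c) *ᵥ (ft *ᵥ u) := by rw [hC3]
          _ = (W * (Γ * (c * ft))) *ᵥ u := by simp only [Matrix.mulVec_mulVec, Matrix.mul_assoc]
          _ = W *ᵥ u := by rw [← hN, hΓ, ← Matrix.mulVec_mulVec, hC3]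
      have hWu : ((βi.map σ)ᵀ * βi) *ᵥ u = 0 := by
        rw [hC4, hW, ← Matrix.mulVec_mulVec, ← Matrix.mulVec_mulVec, hC2, Matrix.mulVec_mulVec] at hA
        exact hA
      have hunit : IsUnit ((βi.map σ)ᵀ * βi) := by
        refine IsUnit.mul ((Matrix.isUnit_iff_isUnit_det _).2 ?_) ((Matrix.isUnit_iff_isUnit_det _).2 hβid)
        rw [Matrix.det_transpose, ← RingHom.mapMatrix_apply, ← RingHom.map_det]
        exact hβid.map σ
      exact Matrix.mulVec_injective_iff_isUnit.2 hunit (hWu.trans (Matrix.mulVec_zero _).symm)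
    refine Matrix.mulVec_injective_iff_isUnit.1 fun u v huv => ?_
    have := key (u - v) (by rw [Matrix.mulVec_sub, huv, sub_self])
    exact sub_eq_zero.1 this

/-- **`U(σ, J')` is the normal closure of its Siegel parabolic** (anti-diagonal model): every `g ∈ U(σ, J')` lies in
the subgroup generated by the `U(σ, J')`-conjugates of the block-upper elements — the case `G = U(n,n)`, `P` = Siegel
parabolic of Margulis' «`G(k)` is generated by `P_ϑ(k)` and `V_ϑ⁻(k)`», here with `V⁻ = w N w⁻¹` conjugate to `N ⊆ P`.
[cite: Margulis1991, Ch. I Prop. 1.2.1] -/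
theorem mem_closure_siegelConjugates_antidiag (hσ : ∀ x, σ (σ x) = x) {θ : K} (hθ : σ θ = -θ) (hθ0 : θ ≠ 0)
    (hτ : τ.map σ = τ) (hτs : τᵀ = τ) (hτu : IsUnit τ.det) {g : GL (ι ⊕ ι) K}
    (hg : g ∈ unitaryGroupOfForm σ (antidiagForm τ)) :
    g ∈ Subgroup.closure (conjugatesOfIn (unitaryGroupOfForm σ (antidiagForm τ)) IsBlockUpper) := by
  obtain ⟨y, hy, hunit⟩ := exists_upperUnipotent_isUnit_block₁₁ σ hσ hθ hθ0 hτ hτs hτu hg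
  have hyU := upperUnipotent_mem σ hy
  have h1 := mem_closure_of_isUnit_block₁₁ σ ((unitaryGroupOfForm σ (antidiagForm τ)).mul_mem hyU hg) hunit
  have h2 : upperUnipotent y ∈ Subgroup.closure (conjugatesOfIn (unitaryGroupOfForm σ (antidiagForm τ)) IsBlockUpper) :=
    Subgroup.subset_closure (mem_conjugatesOfIn_self hyU (isBlockUpper_upperUnipotent y))
  rw [← inv_mul_cancel_left (upperUnipotent y) g]
  exact Subgroup.mul_mem _ (Subgroup.inv_mem _ h2) h1

end Singular

/-! ## §3 The diagonal model `S ⊕ (−S)` and the `Δ`-Siegel condition `p₁₁ + p₁₂ = p₂₁ + p₂₂` -/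

section Diag

/-- the doubled form `S ⊕ (−S)` (Gram matrix of `𝔻 = 𝕍 ⊕ (−𝕍)` in the block enumeration `ι ⊕ ι`).
[cite: HarrisKudlaSweet1996, §1 (1.9)] -/
def diagForm (S : Matrix ι ι K) : Matrix (ι ⊕ ι) (ι ⊕ ι) K := Matrix.fromBlocks S 0 0 (-S)

/-- **`p ∈ P_Δ`**: `p` stabilises the diagonal `Δ = {(u, u)}` of `𝔻 = 𝕍 ⊕ 𝕍`, i.e. `p₁₁ + p₁₂ = p₂₁ + p₂₂`
(the Siegel parabolic of the doubled group). [cite: HarrisKudlaSweet1996, §1 (1.11)] -/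
def IsSiegelSum (g : GL (ι ⊕ ι) K) : Prop :=
  (g : Matrix (ι ⊕ ι) (ι ⊕ ι) K).toBlocks₁₁ + (g : Matrix (ι ⊕ ι) (ι ⊕ ι) K).toBlocks₁₂ =
    (g : Matrix (ι ⊕ ι) (ι ⊕ ι) K).toBlocks₂₁ + (g : Matrix (ι ⊕ ι) (ι ⊕ ι) K).toBlocks₂₂

variable (K ι) in
/-- the change of basis `C = [[1, 1], [1, −1]]` from the `(Δ, Δ⁻)`-adapted enumeration to the `(𝕍, −𝕍)` one
(`C (u, 0) = (u, u)`); invertible as `2 ≠ 0`. [folklore] -/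
def cayley (h2 : (2 : K) ≠ 0) : GL (ι ⊕ ι) K :=
  ⟨Matrix.fromBlocks 1 1 1 (-1),
    Matrix.fromBlocks ((2 : K)⁻¹ • 1) ((2 : K)⁻¹ • 1) ((2 : K)⁻¹ • 1) (-((2 : K)⁻¹ • 1)),
    by
      have hh : (2 : K)⁻¹ • (1 : Matrix ι ι K) + (2 : K)⁻¹ • 1 = 1 := by
        rw [← add_smul, ← two_mul, mul_inv_cancel₀ h2, one_smul]
      simp [Matrix.fromBlocks_multiply, hh, ← Matrix.fromBlocks_one],
    by
      have hh : (2 : K)⁻¹ • (1 : Matrix ι ι K) + (2 : K)⁻¹ • 1 = 1 := by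
        rw [← add_smul, ← two_mul, mul_inv_cancel₀ h2, one_smul]
      simp [Matrix.fromBlocks_multiply, hh, ← Matrix.fromBlocks_one]⟩

/-- underlying matrix of `C`. [folklore] -/
@[simp] private theorem coe_cayley (h2 : (2 : K) ≠ 0) :
    ((cayley K ι h2 : GL (ι ⊕ ι) K) : Matrix (ι ⊕ ι) (ι ⊕ ι) K) = Matrix.fromBlocks 1 1 1 (-1) := rfl

/-- **`σ(C)ᵀ (S ⊕ −S) C = antidiag(S + S, S + S)`**: in the `(Δ, Δ⁻)`-basis the doubled form is anti-diagonal.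
[cite: HarrisKudlaSweet1996, §1 (1.11)] -/
private theorem formCongr_cayley_diagForm (h2 : (2 : K) ≠ 0) (S : Matrix ι ι K) :
    formCongr σ (cayley K ι h2) (diagForm S) = antidiagForm (S + S) := by
  have hC : ((Matrix.fromBlocks 1 1 1 (-1) : Matrix (ι ⊕ ι) (ι ⊕ ι) K).map σ)ᵀ = Matrix.fromBlocks 1 1 1 (-1) := by
    rw [fromBlocks_map_ringHom, map_one_ringHom, map_neg_one_ringHom, Matrix.fromBlocks_transpose,
      Matrix.transpose_one, Matrix.transpose_neg, Matrix.transpose_one]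
  rw [formCongr, coe_cayley, hC, diagForm, antidiagForm]
  simp only [Matrix.fromBlocks_multiply, Matrix.one_mul, Matrix.mul_one, Matrix.mul_zero, zero_add, add_zero,
    Matrix.neg_mul, Matrix.mul_neg, neg_neg, add_neg_cancel]

/-- `q ∈ P_Δ` iff the two left blocks of `q C` agree (`q C` has blocks `(q₁₁ + q₁₂, ⋯ ; q₂₁ + q₂₂, ⋯)`). [folklore] -/
private theorem isSiegelSum_iff_mul_cayley (h2 : (2 : K) ≠ 0) (q : GL (ι ⊕ ι) K) :
    IsSiegelSum q ↔
      ((q : Matrix (ι ⊕ ι) (ι ⊕ ι) K) * (cayley K ι h2 : GL (ι ⊕ ι) K)).toBlocks₁₁ =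
        ((q : Matrix (ι ⊕ ι) (ι ⊕ ι) K) * (cayley K ι h2 : GL (ι ⊕ ι) K)).toBlocks₂₁ := by
  set M := (q : Matrix (ι ⊕ ι) (ι ⊕ ι) K)
  conv_rhs => rw [← Matrix.fromBlocks_toBlocks M, coe_cayley, Matrix.fromBlocks_multiply]
  simp only [Matrix.toBlocks_fromBlocks₁₁, Matrix.toBlocks_fromBlocks₂₁, Matrix.mul_one]
  rfl

/-- A block-upper `p` of the anti-diagonal model becomes a `P_Δ`-element `C p C⁻¹` of the diagonal model.
[cite: HarrisKudlaSweet1996, §1 (1.11)] -/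
private theorem isSiegelSum_cayley_conj (h2 : (2 : K) ≠ 0) {p : GL (ι ⊕ ι) K} (hp : IsBlockUpper p) :
    IsSiegelSum (cayley K ι h2 * p * (cayley K ι h2)⁻¹) := by
  rw [isSiegelSum_iff_mul_cayley h2, Units.val_mul, Units.val_mul, Matrix.mul_assoc, Matrix.mul_assoc,
    ← Units.val_mul, inv_mul_cancel, Units.val_one, Matrix.mul_one, coe_cayley,
    ← Matrix.fromBlocks_toBlocks (p : Matrix (ι ⊕ ι) (ι ⊕ ι) K), Matrix.fromBlocks_multiply]
  have hp' : (p : Matrix (ι ⊕ ι) (ι ⊕ ι) K).toBlocks₂₁ = 0 := hp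
  simp [hp']

/-- **`U(σ, S ⊕ −S)` is the normal closure of its Siegel parabolic `P_Δ`** (block enumeration `ι ⊕ ι`).
Hypotheses: `σ` an involution with an anti-invariant unit `θ`, `2 ≠ 0`, `S` symmetric, `σ`-fixed, with unit
determinant. [cite: Margulis1991, Ch. I Prop. 1.2.1] -/
theorem mem_closure_siegelConjugates_diag (h2 : (2 : K) ≠ 0) (hσ : ∀ x, σ (σ x) = x) {θ : K} (hθ : σ θ = -θ)
    (hθ0 : θ ≠ 0) {S : Matrix ι ι K} (hSσ : S.map σ = S) (hSs : Sᵀ = S) (hSu : IsUnit S.det)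
    {g : GL (ι ⊕ ι) K} (hg : g ∈ unitaryGroupOfForm σ (diagForm S)) :
    g ∈ Subgroup.closure (conjugatesOfIn (unitaryGroupOfForm σ (diagForm S)) IsSiegelSum) := by
  set C : GL (ι ⊕ ι) K := cayley K ι h2
  -- `g' := C⁻¹ g C` lies in the anti-diagonal model
  set g' : GL (ι ⊕ ι) K := C⁻¹ * g * C with hg'
  have hCg : C * g' * C⁻¹ = g := by rw [hg']; group
  have hg'U : g' ∈ unitaryGroupOfForm σ (antidiagForm (S + S)) := by
    rw [← formCongr_cayley_diagForm σ h2 S, ← conj_mem_unitaryGroupOfForm_iff, hCg]; exact hg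
  -- hypotheses on `τ = S + S`
  have hτ : (S + S).map σ = S + S := by rw [Matrix.map_add σ (map_add σ), hSσ]
  have hτs : (S + S)ᵀ = S + S := by rw [Matrix.transpose_add, hSs]
  have hτu : IsUnit (S + S).det := by
    rw [← two_smul K S, Matrix.det_smul]
    exact ((isUnit_iff_ne_zero.2 h2).pow _).mul hSu
  have h' := mem_closure_siegelConjugates_antidiag σ hσ hθ hθ0 hτ hτs hτu hg'U
  -- push forward along conjugation by `C`
  have hle := map_closure_conjugatesOfIn_le (MulAut.conj C).toMonoidHom
    (U := unitaryGroupOfForm σ (antidiagForm (S + S))) (U' := unitaryGroupOfForm σ (diagForm S))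
    (P := IsBlockUpper) (P' := IsSiegelSum)
    (fun x hx => by
      rw [MulEquiv.coe_toMonoidHom, MulAut.conj_apply, conj_mem_unitaryGroupOfForm_iff,
        formCongr_cayley_diagForm σ h2 S]; exact hx)
    (fun p _ hp => by rw [MulEquiv.coe_toMonoidHom, MulAut.conj_apply]; exact isSiegelSum_cayley_conj h2 hp)
  have : g = (MulAut.conj C).toMonoidHom g' := by rw [MulEquiv.coe_toMonoidHom, MulAut.conj_apply, hCg]
  rw [this]
  exact hle (Subgroup.mem_map_of_mem _ h')

end Diag

/-! ## §4 Re-enumerated forms `reindex e e (S ⊕ −S)` (e.g. `e = finSumFinEquiv : Fin n ⊕ Fin n ≃ Fin (n + n)`) -/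

section Reindex

variable {R : Type*} [CommRing R] {m : Type*} [Fintype m] [DecidableEq m] (e : ι ⊕ ι ≃ m)

/-- **`p ∈ P_Δ`** for an invertible matrix indexed by `m` over any commutative ring `R` (e.g. `E`, `𝔸_E`), read
through the enumeration `e : ι ⊕ ι ≃ m`: the blocks `b` of `reindex e.symm e.symm p` satisfy `b₁₁ + b₁₂ = b₂₁ + b₂₂`,
i.e. `p` stabilises the diagonal `Δ` (verbatim the shape of GR-2's `IsSiegelDelta`). [cite: HarrisKudlaSweet1996, §1 (1.11)] -/
def IsSiegelReindex (γ : GL m R) : Prop :=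
  (Matrix.reindex e.symm e.symm (γ : Matrix m m R)).toBlocks₁₁ +
      (Matrix.reindex e.symm e.symm (γ : Matrix m m R)).toBlocks₁₂ =
    (Matrix.reindex e.symm e.symm (γ : Matrix m m R)).toBlocks₂₁ +
      (Matrix.reindex e.symm e.symm (γ : Matrix m m R)).toBlocks₂₂

omit [Fintype ι] [DecidableEq ι] in
/-- The `P_Δ`-condition is preserved by applying a ring homomorphism entrywise (e.g. `E → 𝔸_E`, the map underlying
`UnitaryGroup.toAdelic`): the stabiliser of `Δ` is defined over the base. [cite: HarrisKudlaSweet1996, §1 (1.11)] -/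
theorem IsSiegelReindex.map {R' : Type*} [CommRing R'] (f : R →+* R') {p : GL m R} (hp : IsSiegelReindex e p) :
    IsSiegelReindex e (Matrix.GeneralLinearGroup.map f p) := by
  unfold IsSiegelReindex at hp ⊢
  have hcoe : ((Matrix.GeneralLinearGroup.map f p : GL m R') : Matrix m m R') = (p : Matrix m m R).map f := rfl
  have key : ((Matrix.reindex e.symm e.symm (p : Matrix m m R)).toBlocks₁₁ +
      (Matrix.reindex e.symm e.symm (p : Matrix m m R)).toBlocks₁₂).map f =
      ((Matrix.reindex e.symm e.symm (p : Matrix m m R)).toBlocks₂₁ +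
      (Matrix.reindex e.symm e.symm (p : Matrix m m R)).toBlocks₂₂).map f := by rw [hp]
  rw [Matrix.map_add _ (map_add f), Matrix.map_add _ (map_add f)] at key
  rw [hcoe]
  exact key

omit [Field K] [Fintype m] [DecidableEq m] [Fintype ι] [DecidableEq ι] in
/-- `reindex e.symm e.symm (reindex e e M) = M`. [folklore] -/
private theorem reindex_symm_reindex (M : Matrix (ι ⊕ ι) (ι ⊕ ι) K) :
    Matrix.reindex e.symm e.symm (Matrix.reindex e e M) = M := by
  simp

/-- the `P_Δ`-condition is compatible with re-enumeration. [folklore] -/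
private theorem isSiegelReindex_mapEquiv_iff (p : GL (ι ⊕ ι) K) :
    IsSiegelReindex e (Units.mapEquiv (Matrix.reindexRingEquiv K e).toMulEquiv p : GL m K) ↔ IsSiegelSum p := by
  unfold IsSiegelReindex IsSiegelSum
  have : ((Units.mapEquiv (Matrix.reindexRingEquiv K e).toMulEquiv p : GL m K) : Matrix m m K) =
      Matrix.reindex e e (p : Matrix (ι ⊕ ι) (ι ⊕ ι) K) := rfl
  rw [this, reindex_symm_reindex]

/-- **Main theorem, re-enumerated form.**  For `σ` an involution of the field `K` with an anti-invariant unit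
`θ`, `2 ≠ 0`, and `S` symmetric `σ`-fixed with unit determinant: every element of
`U(σ, reindex e e (S ⊕ −S))` lies in the subgroup generated by the conjugates of its Siegel parabolic `P_Δ`.
[cite: Margulis1991, Ch. I Prop. 1.2.1] -/
theorem mem_closure_siegelConjugates_reindex (h2 : (2 : K) ≠ 0) (hσ : ∀ x, σ (σ x) = x) {θ : K}
    (hθ : σ θ = -θ) (hθ0 : θ ≠ 0) {S : Matrix ι ι K} (hSσ : S.map σ = S) (hSs : Sᵀ = S) (hSu : IsUnit S.det)
    {γ : GL m K} (hγ : γ ∈ unitaryGroupOfForm σ (Matrix.reindex e e (diagForm S))) :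
    γ ∈ Subgroup.closure
      (conjugatesOfIn (unitaryGroupOfForm σ (Matrix.reindex e e (diagForm S))) (IsSiegelReindex e)) := by
  set ψ : GL (ι ⊕ ι) K ≃* GL m K := Units.mapEquiv (Matrix.reindexRingEquiv K e).toMulEquiv
  have hsub : (Matrix.reindex e e (diagForm S)).submatrix e e = diagForm (K := K) S := by
    rw [Matrix.reindex_apply, Matrix.submatrix_submatrix, Equiv.symm_comp_self, Matrix.submatrix_id_id]
  set g := ψ.symm γ with hgdef
  have hψg : ψ g = γ := ψ.apply_symm_apply γ
  have hgU : g ∈ unitaryGroupOfForm σ (diagForm S) := by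
    rw [← hsub, reindex_mem_unitaryGroupOfForm_iff σ e]
    show ψ g ∈ _
    rw [hψg]; exact hγ
  have h' := mem_closure_siegelConjugates_diag σ h2 hσ hθ hθ0 hSσ hSs hSu hgU
  have hle := map_closure_conjugatesOfIn_le ψ.toMonoidHom
    (U := unitaryGroupOfForm σ (diagForm S)) (U' := unitaryGroupOfForm σ (Matrix.reindex e e (diagForm S)))
    (P := IsSiegelSum) (P' := IsSiegelReindex e)
    (fun x hx => by
      rw [MulEquiv.coe_toMonoidHom, ← reindex_mem_unitaryGroupOfForm_iff σ e, hsub]; exact hx)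
    (fun p _ hp => by rw [MulEquiv.coe_toMonoidHom, isSiegelReindex_mapEquiv_iff]; exact hp)
  rw [← hψg]
  exact hle (Subgroup.mem_map_of_mem _ h')

/-- **Consumer form** (typed on the subgroup, for an arbitrary spelling `J` of the form): for
`J = reindex e e (S ⊕ −S)`, every `γ : ↥U(σ, J)` lies in the subgroup closure, inside `↥U(σ, J)`, of
`{h p h⁻¹ ∣ p ∈ P_Δ}`.  (Stub S2 of the GR construction is this with `K = L`, `σ` = complex conjugation,
`e = finSumFinEquiv`, `S = T ⊗ 1`, pushed forward along `UnitaryGroup.toAdelic`: `toAdelic_mem_closure_siegelConjugates`.)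
[cite: Margulis1991, Ch. I Prop. 1.2.1] -/
theorem mem_closure_siegelConjugates_subtype (h2 : (2 : K) ≠ 0) (hσ : ∀ x, σ (σ x) = x) {θ : K}
    (hθ : σ θ = -θ) (hθ0 : θ ≠ 0) {S : Matrix ι ι K} (hSσ : S.map σ = S) (hSs : Sᵀ = S) (hSu : IsUnit S.det)
    (J : Matrix m m K) (hJ : J = Matrix.reindex e e (Matrix.fromBlocks S 0 0 (-S)))
    (γ : unitaryGroupOfForm σ J) :
    γ ∈ Subgroup.closure {x : unitaryGroupOfForm σ J |
      ∃ p h : unitaryGroupOfForm σ J, IsSiegelReindex e (p : GL m K) ∧ x = h * p * h⁻¹} := by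
  subst hJ
  exact mem_closure_subtype_of_mem_closure_conjugatesOfIn γ.2
    (mem_closure_siegelConjugates_reindex σ e h2 hσ hθ hθ0 hSσ hSs hSu γ.2)

end Reindex

/-! ## §5 Rational points of `U(J)` over a quadratic extension of number fields, pushed to `U(J)(𝔸_F)` -/

section Adelic

open _root_.NumberField

variable (F E : Type) [Field F] [Field E] [NumberField E] [Algebra F E] (c : E ≃ₐ[F] E)

/-- **Consumer form for the GR construction (stub S2).**  `E/F` number fields with an involution `c` having an
anti-invariant unit `θ` (e.g. `E` CM, `c` complex conjugation), `J = reindex e e (S ⊕ −S)` with `S` symmetric,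
`c`-fixed, of unit determinant: the image in `U(J)(𝔸_F)` of every rational point `γ ∈ U(J)(F)` lies in the subgroup
generated by the `U(J)(F)`-conjugates of the rational points of the Siegel parabolic `P_Δ` — literally the shape of
`stub_S2_ratH_normalClosure_siegel` (`ratH = toAdelic.range`, `IsSiegelDelta = IsSiegelReindex finSumFinEquiv`).
[cite: Margulis1991, Ch. I Prop. 1.2.1] -/
theorem toAdelic_mem_closure_siegelConjugates (hc : ∀ x, c (c x) = x) {θ : E} (hθ : c θ = -θ) (hθ0 : θ ≠ 0)
    {N : ℕ} (e : ι ⊕ ι ≃ Fin N) {S : Matrix ι ι E} (hSσ : S.map (c : E →+* E) = S) (hSs : Sᵀ = S)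
    (hSu : IsUnit S.det) (J : Matrix (Fin N) (Fin N) E)
    (hJ : J = Matrix.reindex e e (Matrix.fromBlocks S 0 0 (-S))) (γ : UnitaryGroup.rational F E c N J) :
    UnitaryGroup.toAdelic F E c N J γ ∈ Subgroup.closure
      {x : UnitaryGroup.adelic F E c N J |
        ∃ p ∈ (UnitaryGroup.toAdelic F E c N J).range, ∃ h ∈ (UnitaryGroup.toAdelic F E c N J).range,
          IsSiegelReindex e (p : GL (Fin N) (_root_.NumberField.AdeleRing (𝓞 E) E)) ∧ x = h * p * h⁻¹} := by
  set φ := UnitaryGroup.toAdelic F E c N J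
  have hγ := mem_closure_siegelConjugates_subtype (c : E →+* E) e (two_ne_zero : (2 : E) ≠ 0) (fun x => hc x) hθ hθ0
    hSσ hSs hSu J hJ γ
  have hle : (Subgroup.closure {x : UnitaryGroup.rational F E c N J | ∃ p h : UnitaryGroup.rational F E c N J,
      IsSiegelReindex e (p : GL (Fin N) E) ∧ x = h * p * h⁻¹}).map φ ≤
      Subgroup.closure {x : UnitaryGroup.adelic F E c N J |
        ∃ p ∈ φ.range, ∃ h ∈ φ.range, IsSiegelReindex e (p : GL (Fin N) (_root_.NumberField.AdeleRing (𝓞 E) E)) ∧ x = h * p * h⁻¹} := by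
    rw [MonoidHom.map_closure]
    apply Subgroup.closure_mono
    rintro _ ⟨x, ⟨p, h, hp, rfl⟩, rfl⟩
    exact ⟨φ p, ⟨p, rfl⟩, φ h, ⟨h, rfl⟩, hp.map e (algebraMap E (_root_.NumberField.AdeleRing (𝓞 E) E)), by simp [map_mul, map_inv]⟩
  exact hle (Subgroup.mem_map_of_mem φ hγ)

end Adelic

end DoubledUnitary

end Literature.NumberTheory.Automorphic
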